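import Summits.QuantumFields.YangMills.Theorems.LuscherReductionTwistedTraceScalingBOStiffCurrency
import Summits.QuantumFields.YangMills.Theorems.LuscherReductionTwistedTraceScalingBOStiffWeightTransport
import Summits.QuantumFields.YangMills.Theorems.LuscherReductionTwistedTraceScalingBOStiffTailCurrency
import Summits.QuantumFields.YangMills.Theorems.LuscherReductionTwistedTraceScalingBOStiffFibreTail
import Summits.QuantumFields.YangMills.Theorems.LuscherReductionTwistedTraceScalingBOStiffDefs
import HarnessLib

/-!
# (B-ST) (W1-7b) `…BOStiffCoreData`: the record data of the fibre block in the `c`-vocabulary of ✓`…BOStiffDefs` — weight, mass, currency, weight floor, tail budget, final algebra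
# (lane A of S-BASE, crux `TwistedTraceScaling` stmt-QuantumFields-20203, C4-CORE, the (B-ST) pen; HANDOFF-g21 UPDATE 20:39Z (W1-7))

* §1 `cW_props` (measurable, `|cW| ≤ e^{|E|β²}`, `cW ≥ 0`), `fibreMass_eq_cMass` (`fibreMass (softWeight χ) Ω_c 1 = ∫ cΘ²·cW`), `cLambda_num_eq`;
* §2 ★★ `eventually_kappa_cLambda_le` — THE CURRENCY in `c`-form: `∃ M₀ ∀ M ≥ M₀ ∀ a > 0 ∀ᶠ β, (topValue su2Rep 1 (L³β)/K₁(1,1))·cΛ ≤ (1+a)·Λ_rec` (✓`stiff_currency_record`);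
* §3 ★★ `eventually_cW_floor` — `∃ M₀ ∀ M ≥ M₀ ∀ᶠ β, ∀ x ∈ Bal_cap, ‖x̂‖ ≤ r_f ⇒ ½·N̄(β^{-1}) ≤ cW x` (`N̄ = fpWeightBar`; ✓`fpWeight_record_sandwich`, `χ ≤ 1` on the fat tube);
  `fpWeightBar_powScale_ge` (`N̄(β^{-1}) ≥ c·β^{-2·flatDim}` for `β ≥ 2`); ★ `eventually_tau_budget` — `e^{2β|E|}·4e^{−ℓ²}·(P/(½N̄(β^{-1}))) ≤ a·Λ_rec` eventually;
* §4 ★ `core_budget_alg` — the closing real inequality of the core piece (rates `t = θ_*/16`).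
HONEST FRAMING: bookkeeping for a stub of a child of the CONDITIONAL route R2b1; (B-ST) OPEN; C4-CORE OPEN; not infinite volume, not a gap, not Clay.
-/

set_option autoImplicit false

noncomputable section

open MeasureTheory Filter Topology Real
open scoped BigOperators
open Literature.MathematicalPhysics.QuantumFieldTheory
open Literature.MathematicalPhysics.QuantumLattice

namespace Summit.QuantumFields.YangMills.Theorems.FemtoTransferGap.TwoLattice.ConstTube

open Summit.QuantumFields.YangMills.Theorems.FemtoTransferGap
open Summit.QuantumFields.YangMills.Theorems.FemtoTransferGap.TwoLattice
open Summit.QuantumFields.YangMills.Theorems.FemtoTransferGap.TwoLattice.Avg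
open Summit.QuantumFields.YangMills.Theorems.FemtoTransferGap.TwoLattice.Stiff (LinkSpace)
open Summit.QuantumFields.YangMills.Theorems.FemtoTransferGap.TwoLattice.GnChart

variable {L : ℕ} [NeZero L]

/-! ## §1 The weight, the mass and the Rayleigh numerator in `c`-form -/

/-- `cW` is measurable, bounded by `e^{|E|/powScale 1 β²}`, and nonnegative. [folklore] -/
theorem cW_props (s M β : ℝ) :
    Measurable (cW L s M β) ∧ (∀ x, |cW L s M β x| ≤ Real.exp ((Fintype.card (Edge 3 L) : ℝ) / powScale 1 β ^ 2)) ∧ ∀ x, 0 ≤ cW L s M β x := by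
  obtain ⟨hm, hb, h0, -⟩ := softWeight_recordChi_props (L := L) s 43 M β
  exact ⟨hm.comp (measurable_orthoTube_right (L := L) 1), fun x => hb _, fun x => h0 _⟩

/-- `fibreMass (softWeight χ) Ω_c 1 = ∫ cΘ²·cW dπ`. [folklore] -/
theorem fibreMass_eq_cMass (s M β : ℝ) :
    fibreMass L (softWeight (recordChi L s 43 M β)) (cΩ L β) 1 = ∫ x, cΘ L β x ^ 2 * cW L s M β x ∂orthoTransverse L := rfl

/-- The literal hST profile is `cΩ`. [folklore] -/
theorem cΩ_eq (β : ℝ) :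
    (fun x : LinkSpace L => {x : LinkSpace L | linkCurry x ∈ capBalancedSet L}.indicator (fun _ => (1 : ℝ)) x *
        frozenProfile L (fun β' => stiffGaussExp L (β' / 2) β') (fun β' => min (1 / 40) (powScale (1 / 2) β' * btLog β')) β x) = cΩ L β := rfl

/-- `∫∫ cΘ(x) cM(x,y) cΘ(y) = ∫ cΘ(x)·(∫ cM(x,y) cΘ(y))`. [folklore] -/
theorem cLambda_num_eq (β : ℝ) :
    ∫ x, ∫ y, cΘ L β x * cM L β x y * cΘ L β y ∂orthoTransverse L ∂orthoTransverse L =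
      ∫ x, cΘ L β x * ∫ y, cM L β x y * cΘ L β y ∂orthoTransverse L ∂orthoTransverse L := by
  refine integral_congr_ae (ae_of_all _ fun x => ?_)
  show ∫ y, cΘ L β x * cM L β x y * cΘ L β y ∂orthoTransverse L = cΘ L β x * ∫ y, cM L β x y * cΘ L β y ∂orthoTransverse L
  rw [← integral_const_mul]
  refine integral_congr_ae (ae_of_all _ fun y => ?_)
  show cΘ L β x * cM L β x y * cΘ L β y = cΘ L β x * (cM L β x y * cΘ L β y)
  ring

/-! ## §2 ★★ The currency in `c`-form -/

set_option maxHeartbeats 800000 in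
-- record-size expressions.
/-- ★★ **CURRENCY**: `∃ M₀ ≥ 2, ∀ M ≥ M₀, ∀ a > 0, ∀ᶠ β`, `(topValue su2Rep 1 (L³β)/K₁(1,1))·cΛ L s M β ≤ (1+a)·Λ_rec(β)`. [cite: Luscher1983, §3] -/
theorem eventually_kappa_cLambda_le (hLz : Nonempty (NzSite L)) {s : ℝ} (hs : 0 < s) (hs3 : s ≤ 1 / 3) :
    ∃ M₀ : ℝ, 2 ≤ M₀ ∧ ∀ M : ℝ, M₀ ≤ M → ∀ a : ℝ, 0 < a → ∀ᶠ β : ℝ in atTop,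
      topValue su2Rep 1 ((L : ℝ) ^ 3 * β) / transferKernel su2Rep ((L : ℝ) ^ 3 * β) (1 : GaugeConfig 3 1 SU2) 1 * cΛ L s M β ≤
        (1 + a) * (btC L β (fun x : LinkSpace L => {x : LinkSpace L | linkCurry x ∈ capBalancedSet L}.indicator (fun _ => (1 : ℝ)) x * frozenProfile L (fun β' => stiffGaussExp L (β' / 2) β') (fun β' => min (1 / 40) (powScale (1 / 2) β' * btLog β')) β x) (btEps β) (5 * (powScale (1 / 2) β * btLog β ^ 2)) / fpZ (btEps β) / recordGamma L (fun β' => fun x : LinkSpace L => {x : LinkSpace L | linkCurry x ∈ capBalancedSet L}.indicator (fun _ => (1 : ℝ)) x * frozenProfile L (fun β'' => stiffGaussExp L (β'' / 2) β'') (fun β'' => min (1 / 40) (powScale (1 / 2) β'' * btLog β'')) β' x) β *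
          levelValue su2Rep 1 ((L : ℝ) ^ 3 * β) 0) := by
  obtain ⟨M₀, hM₀, H⟩ := stiff_currency_record (L := L) hLz hs hs3
  refine ⟨M₀, hM₀, fun M hM a ha => ?_⟩
  filter_upwards [H M hM a ha] with β hβ
  have e1 : topValue su2Rep 1 ((L : ℝ) ^ 3 * β) = levelValue su2Rep 1 ((L : ℝ) ^ 3 * β) 0 := (levelValue_zero su2Rep 1 _).symm
  have e2 : cΛ L s M β = (∫ x, cΘ L β x * ∫ y, cM L β x y * cΘ L β y ∂orthoTransverse L ∂orthoTransverse L) /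
      fibreMass L (softWeight (recordChi L s 43 M β)) (cΩ L β) 1 := by
    unfold cΛ; rw [cLambda_num_eq, fibreMass_eq_cMass]
  rw [e1, e2]
  exact hβ

/-! ## §3 ★★ The weight floor and the tail budget -/

/-- ★★ **WEIGHT FLOOR ON THE PROFILE'S SUPPORT**: `∃ M₀ ≥ 2, ∀ M ≥ M₀, ∀ᶠ β, ∀ x ∈ Bal_cap, ‖x̂‖ ≤ r_f ⇒ ½·fpWeightBar(β^{-1}) ≤ cW x`. [cite: Luscher1983, §3] -/
theorem eventually_cW_floor (hLz : Nonempty (NzSite L)) {s : ℝ} (hs : 0 < s) (hs3 : s ≤ 1 / 3) :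
    ∃ M₀ : ℝ, 2 ≤ M₀ ∧ ∀ M : ℝ, M₀ ≤ M → ∀ᶠ β : ℝ in atTop, ∀ x ∈ capBalancedSet L, ‖linkEmbed L x‖ ≤ min (1 / 40) (powScale (1 / 2) β * btLog β) →
      fpWeightBar L (powScale 1 β) / 2 ≤ cW L s M β x := by
  obtain ⟨M₀, hM₀, H⟩ := fpWeight_record_sandwich (L := L) hLz hs hs3
  refine ⟨M₀, hM₀, fun M hM => ?_⟩
  obtain ⟨C, β₀, hC, hP⟩ := H M hM
  have hM2 : 2 ≤ M := hM₀.trans hM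
  have hδ : Tendsto (fun β => 43 * powScale s β) atTop (𝓝 0) := by simpa using (tendsto_powScale hs).const_mul 43
  have hδ2 : Tendsto (fun β => (43 * powScale s β) ^ 2) atTop (𝓝 0) := by simpa using hδ.pow 2
  filter_upwards [eventually_ge_atTop β₀, eventually_mul_le_of_tendsto hδ2 C (by norm_num : (0 : ℝ) < 1 / 2),
    eventually_orthoTube_one_mem_fatTube_of_norm_le (L := L) hs (by linarith) hM2] with β hβ₀ hκ hcore x hx hxr
  have hU := hcore x hxr
  obtain ⟨hlo, -⟩ := hP β hβ₀ _ hU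
  have hN0 : 0 < fpWeightBar L (powScale 1 β) := fpWeightBar_pos L (powScale_pos 1 β)
  -- `χ(oT 1 x) = e^{−‖P_Γ x̂‖²/p1²} ∈ (0,1]`
  have hχ : recordChi L s 43 M β (orthoTube L 1 x) = Real.exp (-(‖(gaugeModes L).starProjection (linkEmbed L x)‖ ^ 2 / powScale 1 β ^ 2)) := by
    rw [recordChi_eq_indicator_mul, Set.indicator_of_mem hU, one_mul, gaugeCoordSq_orthoTube 1 hx]
  have hχpos : 0 < recordChi L s 43 M β (orthoTube L 1 x) := by rw [hχ]; exact Real.exp_pos _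
  have hχ1 : recordChi L s 43 M β (orthoTube L 1 x) ≤ 1 := by rw [hχ]; exact Real.exp_le_one_iff.mpr (neg_nonpos.mpr (by positivity))
  have hNlo : fpWeightBar L (powScale 1 β) / 2 ≤ gaugeAvg (recordChi L s 43 M β) (orthoTube L 1 x) := by
    have h1 : fpWeightBar L (powScale 1 β) * (1 / 2) ≤ fpWeightBar L (powScale 1 β) * (1 - C * (43 * powScale s β) ^ 2) :=
      mul_le_mul_of_nonneg_left (by linarith) hN0.le
    linarith
  unfold cW; rw [softWeight_eq_div, le_div_iff₀ hχpos]
  have hN00 : 0 ≤ gaugeAvg (recordChi L s 43 M β) (orthoTube L 1 x) := le_trans (by positivity) hNlo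
  nlinarith [mul_le_mul_of_nonneg_left hχ1 hN00]

/-- `fpWeightBar(β^{-1}) ≥ c·(β^{-1})^{2·flatDim}` for `β ≥ 2`, with an explicit `c > 0`. [folklore] -/
theorem fpWeightBar_powScale_ge :
    ∃ c : ℝ, 0 < c ∧ ∀ β : ℝ, 2 ≤ β → c * powScale 1 β ^ (2 * flatDim L) ≤ fpWeightBar L (powScale 1 β) := by
  refine ⟨((2 * π ^ 2)⁻¹) ^ Fintype.card (NzSite L) * π ^ flatDim L / Real.sqrt (gramDet L 0), by
    have := gramDet_zero_pos L; positivity, fun β hβ => ?_⟩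
  have hp0 : 0 < powScale 1 β := powScale_pos 1 β
  have hp1 : powScale 1 β ≤ 1 / 2 := by
    rw [powScale_eq (by linarith), Real.rpow_neg_one]
    exact (inv_le_inv₀ (by linarith) (by norm_num)).mpr hβ |>.trans (by norm_num)
  have hbase0 : 0 < π * powScale 1 β ^ 2 := by positivity
  have hbase1 : π * powScale 1 β ^ 2 ≤ 1 := by
    have hπ : π ≤ 4 := Real.pi_le_four
    nlinarith [sq_nonneg (powScale 1 β), mul_le_mul hπ (pow_le_pow_left₀ hp0.le hp1 2) (sq_nonneg _) (by norm_num)]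
  have hrpow : (π * powScale 1 β ^ 2) ^ (flatDim L : ℝ) ≤ (π * powScale 1 β ^ 2) ^ ((flatDim L : ℝ) / 2) :=
    Real.rpow_le_rpow_of_exponent_ge hbase0 hbase1 (by have : (0 : ℝ) ≤ flatDim L := Nat.cast_nonneg _; linarith)
  rw [Real.rpow_natCast] at hrpow
  have hsq : 0 < Real.sqrt (gramDet L 0) := Real.sqrt_pos.mpr (gramDet_zero_pos L)
  unfold fpWeightBar
  rw [show ((flatDim L : ℝ) / 2) = (flatDim L / 2 : ℝ) by norm_num] at hrpow
  have e : ((2 * π ^ 2)⁻¹) ^ Fintype.card (NzSite L) * π ^ flatDim L / Real.sqrt (gramDet L 0) * powScale 1 β ^ (2 * flatDim L) =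
      ((2 * π ^ 2)⁻¹) ^ Fintype.card (NzSite L) * (π * powScale 1 β ^ 2) ^ flatDim L / Real.sqrt (gramDet L 0) := by
    rw [mul_pow, ← pow_mul]; ring
  rw [e]
  exact div_le_div_of_nonneg_right (mul_le_mul_of_nonneg_left hrpow (by positivity)) hsq.le

set_option maxHeartbeats 800000 in
-- record-size expressions.
/-- ★ **TAIL BUDGET with the weight floor**: for `P ≥ 0`, `a > 0`, eventually `e^{2β|E|}·(4e^{−ℓ²})·(P/(½ fpWeightBar(β^{-1}))) ≤ a·Λ_rec(β)`. [folklore] -/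
theorem eventually_tau_budget {P a : ℝ} (hP : 0 ≤ P) (ha : 0 < a) :
    ∀ᶠ β : ℝ in atTop,
      Real.exp (β * (2 * (Fintype.card (Edge 3 L) : ℝ))) * (4 * Real.exp (-(btLog β ^ 2))) * (P / (fpWeightBar L (powScale 1 β) / 2)) ≤
        a * (btC L β (fun x : LinkSpace L => {x : LinkSpace L | linkCurry x ∈ capBalancedSet L}.indicator (fun _ => (1 : ℝ)) x * frozenProfile L (fun β' => stiffGaussExp L (β' / 2) β') (fun β' => min (1 / 40) (powScale (1 / 2) β' * btLog β')) β x) (btEps β) (5 * (powScale (1 / 2) β * btLog β ^ 2)) / fpZ (btEps β) / recordGamma L (fun β' => fun x : LinkSpace L => {x : LinkSpace L | linkCurry x ∈ capBalancedSet L}.indicator (fun _ => (1 : ℝ)) x * frozenProfile L (fun β'' => stiffGaussExp L (β'' / 2) β'') (fun β'' => min (1 / 40) (powScale (1 / 2) β'' * btLog β'')) β' x) β *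
          levelValue su2Rep 1 ((L : ℝ) ^ 3 * β) 0) := by
  obtain ⟨cΛ, K, hcΛ, hfloor⟩ := recordLambda_floor (L := L)
  obtain ⟨c, hc, hfp⟩ := fpWeightBar_powScale_ge (L := L)
  -- `8P·e^{−ℓ²} ≤ (a cΛ c)·p1^{K + 2 flatDim}` eventually
  have hsmall := eventually_exp_neg_btLog_sq_le (q := 1) (P := 8 * P) (c := a * cΛ * c) one_pos (by positivity) (by positivity) (K + 2 * flatDim L)
  filter_upwards [hfloor, hsmall, eventually_ge_atTop (2 : ℝ)] with β hΛ hsm hβ2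
  have hp0 : 0 < powScale 1 β := powScale_pos 1 β
  have hN := hfp β hβ2
  have hN0 : 0 < fpWeightBar L (powScale 1 β) := fpWeightBar_pos L hp0
  have hEK : Real.exp (β * (2 * (Fintype.card (Edge 3 L) : ℝ))) = Real.exp (2 * β) ^ Fintype.card (Edge 3 L) := by
    rw [← Real.exp_nat_mul]; ring_nf
  rw [hEK, one_mul] at *
  set EK := Real.exp (2 * β) ^ Fintype.card (Edge 3 L) with hEKdef
  have hEK0 : 0 < EK := by positivity
  -- `4e^{−ℓ²}·(P/(N̄/2)) = 8P e^{−ℓ²}/N̄ ≤ (a cΛ c) p1^{K+2d}/N̄ ≤ a cΛ p1^K`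
  have h1 : 4 * Real.exp (-(btLog β ^ 2)) * (P / (fpWeightBar L (powScale 1 β) / 2)) = 8 * P * Real.exp (-(btLog β ^ 2)) / fpWeightBar L (powScale 1 β) := by
    field_simp; ring
  have h2 : 8 * P * Real.exp (-(btLog β ^ 2)) / fpWeightBar L (powScale 1 β) ≤ a * cΛ * powScale 1 β ^ K := by
    rw [div_le_iff₀ hN0]
    have hsm' : 8 * P * Real.exp (-(btLog β ^ 2)) ≤ a * cΛ * c * powScale 1 β ^ (K + 2 * flatDim L) := by simpa [one_mul] using hsm
    calc 8 * P * Real.exp (-(btLog β ^ 2)) ≤ a * cΛ * c * powScale 1 β ^ (K + 2 * flatDim L) := hsm'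
      _ = a * cΛ * powScale 1 β ^ K * (c * powScale 1 β ^ (2 * flatDim L)) := by rw [pow_add]; ring
      _ ≤ a * cΛ * powScale 1 β ^ K * fpWeightBar L (powScale 1 β) := mul_le_mul_of_nonneg_left hN (by positivity)
  calc EK * (4 * Real.exp (-(btLog β ^ 2))) * (P / (fpWeightBar L (powScale 1 β) / 2))
      = EK * (8 * P * Real.exp (-(btLog β ^ 2)) / fpWeightBar L (powScale 1 β)) := by rw [mul_assoc, h1]
    _ ≤ EK * (a * cΛ * powScale 1 β ^ K) := mul_le_mul_of_nonneg_left h2 hEK0.le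
    _ = a * (cΛ * powScale 1 β ^ K * EK) := by ring
    _ ≤ a * _ := mul_le_mul_of_nonneg_left hΛ ha.le

/-! ## §4 ★ The closing algebra of the core piece -/

/-- ★ **CORE BUDGET**: with `0 ≤ t ≤ 1/16`, `K ≤ (1+t²)Λ` (any sign), `N ≤ (1+t²)X`, `C ≤ t²X`, tail `≤ t²ΛX`, `0 ≤ θ ≤ 1 − 11t`, `A₁ ≤ 1+t`, `A₂ ≤ t`, `ε ≤ t`:
`K·(θN + A₁C + 2A₂√N√C + ε(θ+A₁+2A₂)N) + tail ≤ (1 − t)·Λ·X`. [folklore] -/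
theorem core_budget_alg {t Λ K N C X τT θ A₁ A₂ ε : ℝ} (ht0 : 0 ≤ t) (ht1 : t ≤ 1 / 16) (hΛ : 0 ≤ Λ) (hX : 0 ≤ X) (hN0 : 0 ≤ N) (hC0 : 0 ≤ C)
    (hK : K ≤ (1 + t ^ 2) * Λ) (hN : N ≤ (1 + t ^ 2) * X) (hC : C ≤ t ^ 2 * X) (hτ : τT ≤ t ^ 2 * Λ * X)
    (hθ0 : 0 ≤ θ) (hθ : θ ≤ 1 - 11 * t) (hA₁0 : 0 ≤ A₁) (hA₁ : A₁ ≤ 1 + t) (hA₂0 : 0 ≤ A₂) (hA₂ : A₂ ≤ t) (hε0 : 0 ≤ ε) (hε : ε ≤ t) :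
    K * (θ * N + A₁ * C + 2 * A₂ * (Real.sqrt N * Real.sqrt C) + ε * (θ + A₁ + 2 * A₂) * N) + τT ≤ (1 - t) * Λ * X := by
  -- `2√N√C ≤ N + C`
  have hsq : 2 * (Real.sqrt N * Real.sqrt C) ≤ N + C := by
    have h := two_mul_le_add_sq (Real.sqrt N) (Real.sqrt C)
    rw [Real.sq_sqrt hN0, Real.sq_sqrt hC0] at h; linarith
  have hNX : N ≤ (1 + t ^ 2) * X := hN
  have hX2 : (1 + t ^ 2) * X ≤ 2 * X := mul_le_mul_of_nonneg_right (by nlinarith) hX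
  -- the bracket `S ≤ (1 − 7t)·X`... via the termwise bounds
  have s1 : θ * N ≤ (1 - 11 * t) * ((1 + t ^ 2) * X) := mul_le_mul hθ hNX hN0 (by linarith)
  have s2 : A₁ * C ≤ (1 + t) * (t ^ 2 * X) := mul_le_mul hA₁ hC hC0 (by linarith)
  have s3 : 2 * A₂ * (Real.sqrt N * Real.sqrt C) ≤ t * ((1 + t ^ 2) * X + t ^ 2 * X) := by
    have h1 : 2 * A₂ * (Real.sqrt N * Real.sqrt C) = A₂ * (2 * (Real.sqrt N * Real.sqrt C)) := by ring
    rw [h1]; exact mul_le_mul hA₂ (hsq.trans (add_le_add hNX hC)) (by positivity) ht0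
  have s4 : ε * (θ + A₁ + 2 * A₂) * N ≤ t * 2 * ((1 + t ^ 2) * X) := by
    have hsum : θ + A₁ + 2 * A₂ ≤ 2 := by nlinarith
    have hsum0 : 0 ≤ θ + A₁ + 2 * A₂ := by positivity
    calc ε * (θ + A₁ + 2 * A₂) * N ≤ t * 2 * N := by
          exact mul_le_mul_of_nonneg_right (mul_le_mul hε hsum hsum0 ht0) hN0
      _ ≤ t * 2 * ((1 + t ^ 2) * X) := mul_le_mul_of_nonneg_left hNX (by positivity)
  have hS : θ * N + A₁ * C + 2 * A₂ * (Real.sqrt N * Real.sqrt C) + ε * (θ + A₁ + 2 * A₂) * N ≤ (1 - 7 * t) * X := by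
    have ht2 : t ^ 2 ≤ t / 16 := by nlinarith
    have ht3 : t ^ 3 ≤ t / 256 := by nlinarith
    nlinarith [s1, s2, s3, s4, mul_nonneg ht0 hX, mul_nonneg (mul_nonneg ht0 ht0) hX, mul_nonneg (pow_nonneg ht0 3) hX]
  have hS0 : 0 ≤ θ * N + A₁ * C + 2 * A₂ * (Real.sqrt N * Real.sqrt C) + ε * (θ + A₁ + 2 * A₂) * N := by positivity
  have h1 : K * (θ * N + A₁ * C + 2 * A₂ * (Real.sqrt N * Real.sqrt C) + ε * (θ + A₁ + 2 * A₂) * N) ≤ ((1 + t ^ 2) * Λ) * ((1 - 7 * t) * X) :=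
    mul_le_mul hK hS hS0 (by positivity)
  have h2 : ((1 + t ^ 2) * Λ) * ((1 - 7 * t) * X) + t ^ 2 * Λ * X ≤ (1 - t) * Λ * X := by
    have hΛX : 0 ≤ Λ * X := mul_nonneg hΛ hX
    nlinarith [mul_nonneg ht0 hΛX, mul_nonneg (mul_nonneg ht0 ht0) hΛX, mul_nonneg (pow_nonneg ht0 3) hΛX]
  linarith

end Summit.QuantumFields.YangMills.Theorems.FemtoTransferGap.TwoLattice.ConstTube

end
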